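/-
Copyright (c) 2026 the pub-hodgecm-mathlib formalisation cell (harness21).  Prover seat hodgecm-mathlib-K2E5-p17 (g7), Track B «K2-LIT»,
#184♮ = hLiu418 = `stmt-HodgeConjecture-24832`; (σ) endgame organ, letter (m1)-SPLIT «unimodularity of `U(V′_v)` at a split place» (K2E5-plan (g7) 13:32:33Z,
LEAD F0P6-plan (g14) σ18 (q8)).  FILE 2 of 2: transport along the split reading `U(J)(F_v) ≃ₜ* GL_N(E_w)`.
-/
import Summits.HodgeConjecture.HodgeConjecture.Theorems.K2LiuGLnUnimodular      -- ★ (m1)-SPLIT FILE 1 (K2E5-p17): `isMulRightInvariant_gl_of_isHaarMeasure`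
import Literature.NumberTheory.Automorphic.UnitaryGroupSplitPlace              -- ★ `UnitaryGroup.localPiSplitEquiv : localPi E c N J v ≃ₜ* GL (Fin N) (E_w)`
import Literature.NumberTheory.Automorphic.AdicCompletionLocalField            -- ★ instances: `E_w` is a non-archimedean local field, `Valued.v` compatible
import HarnessLib

/-!
# Crux `HLiu418`, (σ) organ, letter (m1)-SPLIT, FILE 2: THE LOCAL UNITARY GROUP AT A SPLIT PLACE IS UNIMODULAR — every Haar measure on `U(J)(F_v)` is right
# invariant when `v` splits in `E∕F` (`U(J)(F_v) ≃ₜ* GL_N(E_w)`, and `GL_N` of a local field is unimodular)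

Cell `hodgecm-mathlib`, crux item hLiu418 = `stmt-HodgeConjecture-24832`, route of record `HCCMUnconditional`; squad K2 ∕ K2Liu, prover K2E5-p17 (g7).
THEOREMS ONLY (no `def`, no instance, no notation, no named-fact hypothesis, no `sorry`); lane `--supports stmt-HodgeConjecture-24832 --as helper` (count-neutral).

WHY.  The (σ) endgame's V8-inst (K2Liu-p09 (g6), ★ V8d `exists_average`) carries the unimodularity of `G = U(V′_v)` as the BY-VALUE binder
`[μG.IsMulRightInvariant]`; LEAD σ18 wants it for BOTH kinds of place.  Non-split `v`: K2Liu-p12 (g3)'s (m1) head (Cartan road on the quasi-split unitary group,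
★ `K2E3RankOneUnitaryUnimodular` pattern).  SPLIT `v` (this file): the tree's split reading ★ `UnitaryGroup.localPiSplitEquiv : U(J)(F_v) ≃ₜ* GL_N(E_w)` (`u ↦ u_w`,
`w ∣ v` with `c • w ≠ w`; [Mok2014, §1]) carries a Haar measure `μ` of `U(J)(F_v)` to the Haar measure `e_* μ` of `GL_N(E_w)` (Mathlib `ContinuousMulEquiv.isHaarMeasure_map`),
which is right invariant by ★ FILE 1 `isMulRightInvariant_gl_of_isHaarMeasure` (`E_w` is a non-archimedean local field, ★ `AdicCompletionLocalField`, uniformiser from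
Mathlib `valuation_exists_uniformizer`); right invariance comes back along `e⁻¹` (`isMulRightInvariant_of_map_continuousMulEquiv`, generic).
* §1 `isMulRightInvariant_of_map_continuousMulEquiv` (generic: right invariance descends along a topological group isomorphism);
* §2 **`isMulRightInvariant_localPi_of_split`** — the (m1)-SPLIT head: for `c ≠ 1`, `J` `c`-hermitian (`(J.map c)ᵀ = J`) and invertible at `w`, `c • w ≠ w`,
  every Haar measure on `UnitaryGroup.localPi E c N J v` is right invariant (any `N`; the organ uses `N = 3`, `E∕F = L∕L⁺`).
HONEST LABEL: HC_CM is proved only modulo the 7 printed citations (2 remaining named inputs: hLiu418 = stmt-HodgeConjecture-24832, h413 = stmt-HodgeConjecture-24833) until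
rung 0 closes; local structure theory, count-neutral helper, closes no item.
Search: Mathlib `MulEquiv.isHaarMeasure_map`, `isMulLeftInvariant_map` (no right-handed `map` lemma — §1 supplies the equivalence case); tree ★ `localPiSplitEquiv`,
★ `instIsNonarchimedeanLocalFieldAdicCompletion`; dedup `rg "isMulRightInvariant_localPi_of_split|isMulRightInvariant_of_map_continuousMulEquiv"` — none.
References: [Cartier1979] §I.3 (reductive `p`-adic groups are unimodular); [Folland1995] §2.4; [Mok2014] C. P. Mok, *Endoscopic classification of representations of quasi-split unitary groups*, Mem. AMS 235 (2014), §1 (`U(N)(F_v) ≅ GL_N(E_w)` at split `v`).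
-/

set_option autoImplicit false
-- the mandated namespace repeats `HodgeConjecture.HodgeConjecture`
set_option linter.dupNamespace false

noncomputable section

open MeasureTheory MeasureTheory.Measure Set
open scoped ENNReal NNReal Matrix MatrixGroups WithZero Valued Topology

namespace Summit.HodgeConjecture.HodgeConjecture.Cruxes.HLiu418.K2LiuLocalUnitaryUnimodularSplit

open NumberField IsDedekindDomain
open Literature.NumberTheory.Automorphic Literature.NumberTheory.Automorphic.UnitaryGroup
open Summit.HodgeConjecture.HodgeConjecture.Cruxes.HLiu418.K2LiuGLnUnimodular (isMulRightInvariant_gl_of_isHaarMeasure)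

/-! ## §1 Right invariance along a topological group isomorphism -/

/-- **right invariance descends along an isomorphism**: if `e : G ≃ₜ* H` and `e_* μ` is right invariant then so is `μ` (`μ = e⁻¹_* e_* μ` and
`(· g) = e⁻¹ ∘ (· e g) ∘ e`). [cite: Folland1995, §2.4] -/
theorem isMulRightInvariant_of_map_continuousMulEquiv {G H : Type*} [Group G] [TopologicalSpace G] [IsTopologicalGroup G] [MeasurableSpace G] [BorelSpace G]
    [Group H] [TopologicalSpace H] [IsTopologicalGroup H] [MeasurableSpace H] [BorelSpace H] (e : G ≃ₜ* H) (μ : Measure G)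
    (h : (μ.map e).IsMulRightInvariant) : μ.IsMulRightInvariant := by
  refine ⟨fun g => ?_⟩
  have he : Measurable (e : G → H) := e.continuous.measurable
  have hes : Measurable (e.symm : H → G) := e.symm.continuous.measurable
  have hμ : μ = (μ.map e).map e.symm := by
    rw [Measure.map_map hes he]
    have : (e.symm : H → G) ∘ (e : G → H) = id := funext fun x => e.symm_apply_apply x
    rw [this, Measure.map_id]
  have hcomp : (fun x : G => x * g) ∘ (e.symm : H → G) = (e.symm : H → G) ∘ fun y : H => y * e g := by
    funext y
    simp only [Function.comp_apply, map_mul, ContinuousMulEquiv.symm_apply_apply]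
  conv_lhs => rw [hμ]
  rw [Measure.map_map (measurable_mul_const g) hes, hcomp, ← Measure.map_map hes (measurable_mul_const _), h.map_mul_right_eq_self]
  exact hμ.symm

/-! ## §2 The local unitary group at a split place -/

variable {F E : Type} [Field F] [NumberField F] [Field E] [NumberField E] [Algebra F E] [Algebra.IsQuadraticExtension F E]
  (c : E ≃ₐ[F] E) {N : ℕ} (J : Matrix (Fin N) (Fin N) E) {v : HeightOneSpectrum (𝓞 F)}

/-- **(m1)-SPLIT: `U(J)(F_v)` IS UNIMODULAR AT A SPLIT PLACE.**  For `c ≠ 1`, `J` `c`-hermitian and invertible at the place `w ∣ v` with `c • w ≠ w`, every Haar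
measure on the local unitary group `UnitaryGroup.localPi E c N J v` is right invariant: transport along ★ `localPiSplitEquiv : U(J)(F_v) ≃ₜ* GL_N(E_w)` of
★ `isMulRightInvariant_gl_of_isHaarMeasure`. [cite: Cartier1979, §I.3] [cite: Mok2014, §1] [cite: Folland1995, §2.4] -/
theorem isMulRightInvariant_localPi_of_split (hc : c ≠ 1) (hJ : (J.map c)ᵀ = J) (w : PlacesOver E v) (hw : c • w.1 ≠ w.1)
    (hJw : IsUnit (placeForm J w.1)) [MeasurableSpace (localPi E c N J v)] [BorelSpace (localPi E c N J v)]
    (μ : Measure (localPi E c N J v)) [μ.IsHaarMeasure] : μ.IsMulRightInvariant := by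
  letI : MeasurableSpace (GL (Fin N) (w.1.adicCompletion E)) := borel _
  haveI : BorelSpace (GL (Fin N) (w.1.adicCompletion E)) := ⟨rfl⟩
  set e := localPiSplitEquiv c J hc hJ w hw hJw with he
  haveI : (μ.map e).IsHaarMeasure := e.isHaarMeasure_map μ
  -- a uniformiser of `E_w`
  obtain ⟨π, hπ⟩ := w.1.valuation_exists_uniformizer E
  have hϖ : Valued.v (π : w.1.adicCompletion E) = WithZero.exp (-1 : ℤ) := by
    rw [HeightOneSpectrum.valuedAdicCompletion_eq_valuation', hπ]
  exact isMulRightInvariant_of_map_continuousMulEquiv e μ (isMulRightInvariant_gl_of_isHaarMeasure N hϖ (μ.map e))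

end Summit.HodgeConjecture.HodgeConjecture.Cruxes.HLiu418.K2LiuLocalUnitaryUnimodularSplit

end
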